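import Literature.NumberTheory.Transcendental.ZeroEstModel
import Mathlib.RingTheory.MvPolynomial.EulerIdentity
import Mathlib.Algebra.MvPolynomial.Derivation
import Mathlib.Analysis.Calculus.LineDeriv.Basic
import Mathlib.Analysis.Calculus.Deriv.Mul
import Mathlib.Analysis.Calculus.Deriv.Add
import Mathlib.Analysis.Calculus.Deriv.Comp
import Mathlib.Analysis.Calculus.Deriv.Inv
import Mathlib.Analysis.Calculus.IteratedDeriv.Lemmas
import Mathlib.Analysis.Calculus.FDeriv.Analytic
import Mathlib.Analysis.Analytic.Order
import Mathlib.Analysis.Analytic.Constructions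
import HarnessLib

/-!
# Zero estimates on commutative algebraic groups, IV: invariant derivations on forms, orders of vanishing

Topic `Literature/NumberTheory/Transcendental`. Fourth module of the discharge of
`Literature.NumberTheory.Transcendental.philippon1986_std` through D. Roy's exposition of
Philippon's zero estimate (Nesterenko–Philippon (eds.), LNM 1752, Ch. 11, §3.1 "Derivatives of
functions along `W`") for an abstract analytic group model `M : AnalyticGroupModel V N`
(`ZeroEstModel.lean`). Roy differentiates regular functions `P/Q` on `G` along the analytic
subgroup `exp_G(W)` (Lemma 3.1, Def. 3.2); for the linear group the tree does this with the global
invariant derivations of `ℂ[X, Y]` (`PhilipponZeroEstimateOperators/Order.lean`). Here the field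
`wronsk` of the structure (`Θ_J ∂_xΘ_I - Θ_I ∂_xΘ_J = Q_{x,I,J}(Θ)`, `Q` quadratic) provides, for
every chart index `J₀` and direction `x ∈ V`, a **derivation of the polynomial ring raising degrees
by one** which lifts `∂_x` acting on the dehomogenised functions `P/X_{J₀}^D`:

* `M.chartDer J₀ x = ∑_I Q_{x,I,J₀} ∂/∂X_I` (a `ℂ`-derivation of `R = ℂ[X₀,…,X_N]`; on a form of
  degree `D` it is a form of degree `D + 1`, `isHomogeneous_chartDer`), and **the key identity**
  `F_{𝒟P}(w) = Θ_{J₀}(w) ∂_xF_P(w) - D F_P(w) ∂_xΘ_{J₀}(w)` (`F_chartDer`, Euler's identity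
  `∑ X_I ∂_I P = D P` and the chain rule along the line `w + tx`), i.e. on the chart
  `{Θ_{J₀} ≠ 0}`: `F_{𝒟P} = Θ_{J₀}^{D+1} ∂_x(F_P/Θ_{J₀}^D)` (`F_chartDer_eq_pow_mul_lineDeriv`);
  hence `𝒟(𝔊) ⊆ 𝔊` (`chartDer_mem_relIdeal`) and, iterating,
  **`F_{𝒟^kP}(w) = Θ_{J₀}(w)^{D+k} · d^k/dt^k (F_P/Θ_{J₀}^D)(w + tx)|₀`**
  (`F_chartDer_iterate`): pure words in `𝒟 = 𝒟_x` are the line jets of the chart function.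
* **Orders of vanishing** (Roy Def. 3.2; the shape of `GaGmE.Std.VanishesAlong`):
  `M.VanishesToOrder W F a T` — all line jets `d^k/dt^k F(a + tx)|₀`, `x ∈ W`, `k < T`, vanish;
  monotonicity, `T = 1 ↔ F(a) = 0`, stability under multiplication by an entire function
  (`VanishesToOrder.mul_left`, additivity of `analyticOrderAt`) and under `F_P ↦ F_{BP}`, `F_{P+Q}`;
  **the bridge to pure words** (`vanishesToOrder_iff_chartDer`): at a point `a` with `Θ_{J₀}(a) ≠ 0`,
  a form `P` vanishes to order `T` along `W` at `a` iff `F_{𝒟_x^k P}(a) = 0` for all `x ∈ W`,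
  `k < T`.

Mixed words, their symmetry and linearity modulo `𝔊`, and polarisation are in the sequel.
Everything is PROVED.

## References

* Yu. V. Nesterenko, P. Philippon (eds.), *Introduction to Algebraic Independence Theory*,
  LNM 1752, Springer 2001, Ch. 11 (D. Roy), §3.1, Lemma 3.1, Def. 3.2. [NesterenkoPhilippon2001]
* P. Philippon, *Lemmes de zéros dans les groupes algébriques commutatifs*, Bull. Soc. Math.
  France 114 (1986), 355–383, §4 (opérateurs de dérivation). [Philippon1986]
-/

noncomputable section

open MvPolynomial Set Filter Topology
open scoped Pointwise

namespace Literature.NumberTheory.Transcendental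

namespace AnalyticGroupModel

variable {V : Type*} [NormedAddCommGroup V] [NormedSpace ℂ V] {N : ℕ} (M : AnalyticGroupModel V N)

attribute [local instance] MvPolynomial.gradedAlgebra

/-- `F_0 = 0`. [folklore] -/
@[simp] theorem F_zero (w : V) : M.F 0 w = 0 := by simp [F]

/-! ### Derivations of the polynomial ring given on the variables -/

/-- The derivation with prescribed values on the variables, as a sum: `D P = ∑_I D(X_I) ∂_I P`.
[folklore] -/
theorem mkDerivation_apply_eq_sum {σ : Type*} [Fintype σ] [DecidableEq σ]
    (f : σ → MvPolynomial σ ℂ) (P : MvPolynomial σ ℂ) :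
    mkDerivation ℂ f P = ∑ I, f I * pderiv I P := by
  induction P using MvPolynomial.induction_on with
  | C c => simp [derivation_C]
  | add p q hp hq => simp only [map_add, hp, hq, mul_add, Finset.sum_add_distrib]
  | mul_X p i hp =>
    rw [Derivation.leibniz, mkDerivation_X, hp, smul_eq_mul, smul_eq_mul]
    have : ∀ J, f J * pderiv J (p * X i) =
        X i * (f J * pderiv J p) + p * (f J * Pi.single (M := fun _ => MvPolynomial σ ℂ) J 1 i) := by
      intro J
      rw [Derivation.leibniz, pderiv_X, smul_eq_mul, smul_eq_mul]
      ring
    simp only [this, Finset.sum_add_distrib, ← Finset.mul_sum]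
    rw [add_comm (p * f i)]
    congr 1
    congr 1
    rw [Finset.sum_eq_single i]
    · simp
    · intro J _ hJ; simp [Pi.single_eq_of_ne hJ.symm]
    · simp

/-! ### The chain rule along a line -/

/-- `t ↦ Θ_I(w + t x)` is differentiable. [folklore] -/
theorem differentiableAt_Θ_line (I : Fin (N + 1)) (w x : V) (t : ℂ) :
    DifferentiableAt ℂ (fun t : ℂ => M.Θ I (w + t • x)) t := by
  have h1 : DifferentiableAt ℂ (M.Θ I) (w + t • x) := ((M.analyticOnNhd_Θ I) _ trivial).differentiableAt
  have h2 : DifferentiableAt ℂ (fun t : ℂ => w + t • x) t :=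
    (differentiableAt_const _).add (differentiableAt_id.smul_const x)
  exact h1.comp t h2

/-- **Chain rule**: `d/dt F_P(w + t x) = ∑_I (∂_I P)(Θ(w + tx)) · d/dt Θ_I(w + tx)`. [folklore] -/
theorem hasDerivAt_F_line (P : MvPolynomial (Fin (N + 1)) ℂ) (w x : V) (t₀ : ℂ) :
    HasDerivAt (fun t : ℂ => M.F P (w + t • x))
      (∑ I, M.F (pderiv I P) (w + t₀ • x) * deriv (fun t : ℂ => M.Θ I (w + t • x)) t₀) t₀ := by
  classical
  induction P using MvPolynomial.induction_on with
  | C c =>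
    have h := hasDerivAt_const t₀ c
    have heq : (∑ I, M.F (pderiv I (C c : MvPolynomial (Fin (N + 1)) ℂ)) (w + t₀ • x) *
        deriv (fun t : ℂ => M.Θ I (w + t • x)) t₀) = 0 :=
      Finset.sum_eq_zero fun I _ => by simp
    rw [heq]
    simpa using h
  | add p q hp hq =>
    have h := hp.add hq
    have heq : (fun t : ℂ => M.F (p + q) (w + t • x)) =
        fun t => M.F p (w + t • x) + M.F q (w + t • x) := by funext t; simp
    rw [heq]
    refine h.congr_deriv ?_
    simp only [map_add, F_add, add_mul, Finset.sum_add_distrib]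
  | mul_X p I hp =>
    have hΘ := (M.differentiableAt_Θ_line I w x t₀).hasDerivAt
    have h := hp.mul hΘ
    have heq : (fun t : ℂ => M.F (p * X I) (w + t • x)) =
        fun t => M.F p (w + t • x) * M.Θ I (w + t • x) := by
      funext t; simp
    rw [heq]
    refine h.congr_deriv ?_
    simp only [Derivation.leibniz, pderiv_X, smul_eq_mul, F_add, F_mul, F_X, add_mul,
      Finset.sum_add_distrib]
    have e1 : ∑ J, M.F p (w + t₀ • x) * M.F (Pi.single (M := fun _ => MvPolynomial (Fin (N + 1)) ℂ) J 1 I)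
        (w + t₀ • x) * deriv (fun t : ℂ => M.Θ J (w + t • x)) t₀ =
        M.F p (w + t₀ • x) * deriv (fun t : ℂ => M.Θ I (w + t • x)) t₀ := by
      rw [Finset.sum_eq_single I]
      · have : M.F (1 : MvPolynomial (Fin (N + 1)) ℂ) (w + t₀ • x) = 1 := by simp [F]
        simp [this]
      · intro J _ hJ
        simp [Pi.single_eq_of_ne hJ.symm]
      · simp
    have e2 : ∑ J, M.Θ I (w + t₀ • x) * M.F (pderiv J p) (w + t₀ • x) * deriv (fun t : ℂ => M.Θ J (w + t • x)) t₀ =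
        (∑ J, M.F (pderiv J p) (w + t₀ • x) * deriv (fun t : ℂ => M.Θ J (w + t • x)) t₀) * M.Θ I (w + t₀ • x) := by
      rw [Finset.sum_mul]
      exact Finset.sum_congr rfl fun J _ => by ring
    rw [e1, e2]
    ring

/-- The line derivative of `F_P`: `∂_x F_P(w) = ∑_I F_{∂_I P}(w) ∂_xΘ_I(w)`. [folklore] -/
theorem lineDeriv_F (P : MvPolynomial (Fin (N + 1)) ℂ) (w x : V) :
    lineDeriv ℂ (M.F P) w x = ∑ I, M.F (pderiv I P) w * lineDeriv ℂ (M.Θ I) w x := by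
  have h := (M.hasDerivAt_F_line P w x 0).deriv
  simp only [zero_smul, add_zero] at h
  exact h

/-! ### The chart derivations -/

/-- **The chart derivation `𝒟 = 𝒟_{J₀,x} = ∑_I Q_{x,I,J₀} ∂/∂X_I`** of `ℂ[X₀, …, X_N]` attached to
a chart index `J₀` and a direction `x ∈ V`: it lifts the invariant derivation `∂_x` acting on the
chart functions `P/X_{J₀}^D` (`F_chartDer_eq_pow_mul_lineDeriv`).
[cite: NesterenkoPhilippon2001, Ch. 11 Lemma 3.1] -/
def chartDer (J₀ : Fin (N + 1)) (x : V) :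
    Derivation ℂ (MvPolynomial (Fin (N + 1)) ℂ) (MvPolynomial (Fin (N + 1)) ℂ) :=
  mkDerivation ℂ fun I => M.wronsk x I J₀

/-- `𝒟 P = ∑_I Q_{x,I,J₀} ∂_I P`. [folklore] -/
theorem chartDer_apply (J₀ : Fin (N + 1)) (x : V) (P : MvPolynomial (Fin (N + 1)) ℂ) :
    M.chartDer J₀ x P = ∑ I, M.wronsk x I J₀ * pderiv I P := by
  classical
  exact mkDerivation_apply_eq_sum _ P

/-- `𝒟` of a form of degree `D` is a form of degree `D + 1`. [folklore] -/
theorem isHomogeneous_chartDer (J₀ : Fin (N + 1)) (x : V) {P : MvPolynomial (Fin (N + 1)) ℂ} {D : ℕ}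
    (hP : P.IsHomogeneous D) : (M.chartDer J₀ x P).IsHomogeneous (D + 1) := by
  rw [chartDer_apply]
  rcases Nat.eq_zero_or_pos D with rfl | hD
  · -- a form of degree `0` is a constant: all `∂_I P = 0`
    have hPC : P = C (coeff 0 P) :=
      totalDegree_eq_zero_iff_eq_C.mp ((totalDegree_zero_iff_isHomogeneous _).mpr hP)
    have : ∀ I, pderiv I P = 0 := fun I => by rw [hPC, pderiv_C]
    simp only [this, mul_zero, Finset.sum_const_zero]
    exact isHomogeneous_zero _ _ _
  · refine IsHomogeneous.sum _ _ _ fun I _ => ?_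
    have h := (M.isHomogeneous_wronsk x I J₀).mul (hP.pderiv (i := I))
    rwa [show 2 + (D - 1) = D + 1 by omega] at h

/-- **The key identity**: `F_{𝒟P}(w) = Θ_{J₀}(w)·∂_xF_P(w) - D·F_P(w)·∂_xΘ_{J₀}(w)` for a form of
degree `D` (Euler's identity and the chain rule). [cite: NesterenkoPhilippon2001, Ch. 11 Lemma 3.1] -/
theorem F_chartDer (J₀ : Fin (N + 1)) (x : V) {P : MvPolynomial (Fin (N + 1)) ℂ} {D : ℕ}
    (hP : P.IsHomogeneous D) (w : V) :
    M.F (M.chartDer J₀ x P) w =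
      M.Θ J₀ w * lineDeriv ℂ (M.F P) w x - D * M.F P w * lineDeriv ℂ (M.Θ J₀) w x := by
  rw [chartDer_apply, lineDeriv_F]
  simp only [F, map_sum, map_mul]
  have hW : ∀ I, eval (M.pt w) (M.wronsk x I J₀) =
      M.Θ J₀ w * lineDeriv ℂ (M.Θ I) w x - M.Θ I w * lineDeriv ℂ (M.Θ J₀) w x := fun I =>
    (M.F_wronsk x I J₀ w).symm
  simp only [hW, sub_mul, Finset.sum_sub_distrib, Finset.mul_sum]
  congr 1
  · exact Finset.sum_congr rfl fun I _ => by ring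
  · -- Euler: `∑_I Θ_I ∂_I P (Θ) = D F_P`
    have hE := congrArg (eval (M.pt w)) hP.sum_X_mul_pderiv
    rw [map_sum, map_nsmul] at hE
    simp only [map_mul, eval_X, pt_apply] at hE
    rw [nsmul_eq_mul] at hE
    calc ∑ I, M.Θ I w * lineDeriv ℂ (M.Θ J₀) w x * eval (M.pt w) (pderiv I P)
        = (∑ I, M.Θ I w * eval (M.pt w) (pderiv I P)) * lineDeriv ℂ (M.Θ J₀) w x := by
          rw [Finset.sum_mul]; exact Finset.sum_congr rfl fun I _ => by ring
      _ = D * eval (M.pt w) P * lineDeriv ℂ (M.Θ J₀) w x := by rw [hE]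

/-- **`𝒟(𝔊) ⊆ 𝔊`.** [cite: NesterenkoPhilippon2001, Ch. 11 Lemma 3.1] -/
theorem chartDer_mem_relIdeal (J₀ : Fin (N + 1)) (x : V) {P : MvPolynomial (Fin (N + 1)) ℂ}
    (hP : P ∈ M.relIdeal) : M.chartDer J₀ x P ∈ M.relIdeal := by
  -- reduce to homogeneous components
  rw [← sum_homogeneousComponent P, map_sum]
  refine Ideal.sum_mem _ fun d _ => ?_
  have hPd : homogeneousComponent d P ∈ M.relIdeal := M.homogeneousComponent_mem_vanishing hP d
  have hhom := homogeneousComponent_isHomogeneous d P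
  rw [M.mem_relIdeal_iff_of_isHomogeneous (M.isHomogeneous_chartDer J₀ x hhom)]
  intro w
  have h0 : M.F (homogeneousComponent d P) = 0 := by
    funext w'
    exact (M.mem_relIdeal_iff_of_isHomogeneous hhom).mp hPd w'
  rw [M.F_chartDer J₀ x hhom, h0]
  simp [lineDeriv]

/-- `F`-values of `𝒟P` depend only on the function `F_P` (and the degree). [folklore] -/
theorem F_chartDer_congr (J₀ : Fin (N + 1)) (x : V) {P Q : MvPolynomial (Fin (N + 1)) ℂ} {D : ℕ}
    (hP : P.IsHomogeneous D) (hQ : Q.IsHomogeneous D) (h : M.F P = M.F Q) :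
    M.F (M.chartDer J₀ x P) = M.F (M.chartDer J₀ x Q) := by
  funext w
  rw [M.F_chartDer J₀ x hP, M.F_chartDer J₀ x hQ, h]

/-! ### The chart: `F_{𝒟P} = Θ_{J₀}^{D+1} ∂_x(F_P/Θ_{J₀}^D)` -/

/-- `t ↦ F_P(w + tx)` is differentiable. [folklore] -/
theorem differentiableAt_F_line (P : MvPolynomial (Fin (N + 1)) ℂ) (w x : V) (t : ℂ) :
    DifferentiableAt ℂ (fun t : ℂ => M.F P (w + t • x)) t :=
  (M.hasDerivAt_F_line P w x t).differentiableAt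

/-- `t ↦ F_P(w + tx)` is analytic. [folklore] -/
theorem analyticAt_F_line (P : MvPolynomial (Fin (N + 1)) ℂ) (w x : V) (t : ℂ) :
    AnalyticAt ℂ (fun t : ℂ => M.F P (w + t • x)) t := by
  have h1 : AnalyticAt ℂ (M.F P) (w + t • x) := (M.analyticOnNhd_F P) _ trivial
  have h2 : AnalyticAt ℂ (fun t : ℂ => w + t • x) t :=
    analyticAt_const.add (analyticAt_id.smul analyticAt_const)
  exact AnalyticAt.comp (g := M.F P) (f := fun t : ℂ => w + t • x) h1 h2

/-- `t ↦ Θ_I(w + tx)` is analytic. [folklore] -/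
theorem analyticAt_Θ_line (I : Fin (N + 1)) (w x : V) (t : ℂ) :
    AnalyticAt ℂ (fun t : ℂ => M.Θ I (w + t • x)) t := by
  have := M.analyticAt_F_line (X I) w x t
  simpa using this

/-- **On the chart `{Θ_{J₀} ≠ 0}`**: `F_{𝒟P}(w) = Θ_{J₀}(w)^{D+1} · d/dt (F_P/Θ_{J₀}^D)(w + tx)|₀`.
[cite: NesterenkoPhilippon2001, Ch. 11 Lemma 3.1] -/
theorem F_chartDer_eq_pow_mul_deriv (J₀ : Fin (N + 1)) (x : V) {P : MvPolynomial (Fin (N + 1)) ℂ}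
    {D : ℕ} (hP : P.IsHomogeneous D) {w : V} (hw : M.Θ J₀ w ≠ 0) :
    M.F (M.chartDer J₀ x P) w =
      M.Θ J₀ w ^ (D + 1) * deriv (fun t : ℂ => M.F P (w + t • x) / M.Θ J₀ (w + t • x) ^ D) 0 := by
  have hf := (M.differentiableAt_F_line P w x 0).hasDerivAt
  have hg : HasDerivAt (fun t : ℂ => M.Θ J₀ (w + t • x) ^ D)
      (D * M.Θ J₀ (w + (0 : ℂ) • x) ^ (D - 1) * deriv (fun t : ℂ => M.Θ J₀ (w + t • x)) 0) 0 :=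
    (M.differentiableAt_Θ_line J₀ w x 0).hasDerivAt.pow D
  have hg0 : M.Θ J₀ (w + (0 : ℂ) • x) ^ D ≠ 0 := by simpa using pow_ne_zero D hw
  have hquot : HasDerivAt (fun t : ℂ => M.F P (w + t • x) / M.Θ J₀ (w + t • x) ^ D) _ 0 := hf.div hg hg0
  rw [hquot.deriv, M.F_chartDer J₀ x hP w]
  simp only [zero_smul, add_zero, lineDeriv]
  rcases Nat.eq_zero_or_pos D with rfl | hD
  · simp
  · obtain ⟨D', rfl⟩ : ∃ D', D = D' + 1 := ⟨D - 1, by omega⟩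
    simp only [Nat.add_sub_cancel]
    field_simp
    ring

/-- **Iterated chart derivations are line jets of the chart function**: for `Θ_{J₀}(w) ≠ 0`,
`F_{𝒟^k P}(w) = Θ_{J₀}(w)^{D+k} · d^k/dt^k (F_P/Θ_{J₀}^D)(w + tx)|₀`.
[cite: NesterenkoPhilippon2001, Ch. 11 Lemma 3.3, Def. 3.2] -/
theorem F_chartDer_iterate (J₀ : Fin (N + 1)) (x : V) {P : MvPolynomial (Fin (N + 1)) ℂ} {D : ℕ}
    (hP : P.IsHomogeneous D) (k : ℕ) {w : V} (hw : M.Θ J₀ w ≠ 0) :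
    M.F ((M.chartDer J₀ x)^[k] P) w = M.Θ J₀ w ^ (D + k) *
      iteratedDeriv k (fun t : ℂ => M.F P (w + t • x) / M.Θ J₀ (w + t • x) ^ D) 0 := by
  induction k generalizing w with
  | zero =>
    simp only [Function.iterate_zero, id_eq, add_zero, iteratedDeriv_zero, zero_smul]
    field_simp
  | succ k ih =>
    rw [Function.iterate_succ_apply']
    have hQ : ((M.chartDer J₀ x)^[k] P).IsHomogeneous (D + k) := by
      clear ih
      induction k with
      | zero => simpa using hP
      | succ k ih' =>
        rw [Function.iterate_succ_apply', show D + (k + 1) = (D + k) + 1 by ring]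
        exact M.isHomogeneous_chartDer J₀ x ih'
    rw [M.F_chartDer_eq_pow_mul_deriv J₀ x hQ hw, show D + (k + 1) = (D + k) + 1 by ring,
      iteratedDeriv_succ]
    congr 1
    -- the two functions of `t` agree near `0`: at `t` near `0`, `Θ_{J₀}(w + tx) ≠ 0` and `ih` applies
    apply Filter.EventuallyEq.deriv_eq
    have hev : ∀ᶠ t : ℂ in 𝓝 0, M.Θ J₀ (w + t • x) ≠ 0 := by
      have hc : ContinuousAt (fun t : ℂ => M.Θ J₀ (w + t • x)) 0 :=
        (M.differentiableAt_Θ_line J₀ w x 0).continuousAt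
      exact hc.eventually_ne (by simpa using hw)
    filter_upwards [hev] with s hs
    rw [ih hs, mul_div_cancel_left₀ _ (pow_ne_zero _ hs)]
    -- shift of the line parameter
    have hshift : (fun t : ℂ => M.F P (w + s • x + t • x) / M.Θ J₀ (w + s • x + t • x) ^ D) =
        fun t : ℂ => (fun u : ℂ => M.F P (w + u • x) / M.Θ J₀ (w + u • x) ^ D) (s + t) := by
      funext t; simp only [add_smul, add_assoc]
    rw [hshift]
    have := congr_fun (iteratedDeriv_comp_const_add k
      (fun u : ℂ => M.F P (w + u • x) / M.Θ J₀ (w + u • x) ^ D) s) 0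
    simpa using this

/-! ### Orders of vanishing along a subspace (Roy Def. 3.2) -/

/-- **`F` vanishes to order (at least) `T` along `W` at `a`**: all line jets
`d^k/dt^k F(a + tx)|₀`, `x ∈ W`, `k < T`, vanish (Roy's "vanishes to order `> T - 1`"; this is the
shape of `GaGmE.Std.VanishesAlong`). [cite: NesterenkoPhilippon2001, Ch. 11 Def. 3.2] -/
def VanishesToOrder (W : Submodule ℂ V) (F : V → ℂ) (a : V) (T : ℕ) : Prop :=
  ∀ x ∈ W, ∀ k < T, iteratedDeriv k (fun t : ℂ => F (a + t • x)) 0 = 0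

omit M in
/-- Order `0` is no condition. [folklore] -/
@[simp] theorem vanishesToOrder_zero (W : Submodule ℂ V) (F : V → ℂ) (a : V) : VanishesToOrder W F a 0 :=
  fun _ _ _ hk => absurd hk (Nat.not_lt_zero _)

omit M in
/-- Monotonicity in the order. [folklore] -/
theorem VanishesToOrder.mono {W : Submodule ℂ V} {F : V → ℂ} {a : V} {T T' : ℕ}
    (h : VanishesToOrder W F a T) (hT : T' ≤ T) : VanishesToOrder W F a T' :=
  fun x hx k hk => h x hx k (lt_of_lt_of_le hk hT)

omit M in
/-- Monotonicity in the subspace. [folklore] -/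
theorem VanishesToOrder.anti {W W' : Submodule ℂ V} {F : V → ℂ} {a : V} {T : ℕ}
    (h : VanishesToOrder W F a T) (hW : W' ≤ W) : VanishesToOrder W' F a T :=
  fun x hx k hk => h x (hW hx) k hk

omit M in
/-- Order `≥ 1` just means `F(a) = 0`. [folklore] -/
theorem vanishesToOrder_one_iff (W : Submodule ℂ V) (F : V → ℂ) (a : V) :
    VanishesToOrder W F a 1 ↔ F a = 0 := by
  constructor
  · intro h; simpa using h 0 W.zero_mem 0 Nat.zero_lt_one
  · intro h x _ k hk
    obtain rfl : k = 0 := Nat.lt_one_iff.mp hk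
    simpa using h

omit M in
/-- A function vanishing to positive order vanishes at the point. [folklore] -/
theorem VanishesToOrder.apply_eq_zero {W : Submodule ℂ V} {F : V → ℂ} {a : V} {T : ℕ}
    (h : VanishesToOrder W F a T) (hT : 0 < T) : F a = 0 :=
  (vanishesToOrder_one_iff W F a).mp (h.mono hT)

omit M in
/-- **Order transfer through an analytic factor** (one variable): if `f, g` are analytic at `0` then
vanishing of the first `T` derivatives of `f` at `0` implies that of `g·f` (the analytic order is
additive). [folklore] -/
theorem forall_iteratedDeriv_mul_eq_zero {f g : ℂ → ℂ} (hf : AnalyticAt ℂ f 0) (hg : AnalyticAt ℂ g 0)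
    {T : ℕ} (h : ∀ k < T, iteratedDeriv k f 0 = 0) : ∀ k < T, iteratedDeriv k (fun z => g z * f z) 0 = 0 := by
  change ∀ k < T, iteratedDeriv k (g * f) 0 = 0
  rw [← natCast_le_analyticOrderAt_iff_iteratedDeriv_eq_zero (hg.mul hf), analyticOrderAt_mul hg hf]
  rw [← natCast_le_analyticOrderAt_iff_iteratedDeriv_eq_zero hf] at h
  exact le_add_left h

omit M in
/-- **Order transfer through a non-vanishing analytic factor** (one variable): with `g(0) ≠ 0` the
vanishing of the first `T` derivatives of `g·f` and of `f` at `0` are equivalent. [folklore] -/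
theorem forall_iteratedDeriv_mul_eq_zero_iff_of_ne_zero {f g : ℂ → ℂ} (hf : AnalyticAt ℂ f 0)
    (hg : AnalyticAt ℂ g 0) (hg0 : g 0 ≠ 0) (T : ℕ) :
    (∀ k < T, iteratedDeriv k (fun z => g z * f z) 0 = 0) ↔ ∀ k < T, iteratedDeriv k f 0 = 0 := by
  change (∀ k < T, iteratedDeriv k (g * f) 0 = 0) ↔ _
  rw [← natCast_le_analyticOrderAt_iff_iteratedDeriv_eq_zero (hg.mul hf), analyticOrderAt_mul hg hf,
    ← natCast_le_analyticOrderAt_iff_iteratedDeriv_eq_zero hf, (hg.analyticOrderAt_eq_zero).mpr hg0,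
    zero_add]

/-- **Stability under multiplication by an entire function.** [cite: NesterenkoPhilippon2001, Ch. 11 Prop. 3.8 Step 1] -/
theorem VanishesToOrder.mul_left {W : Submodule ℂ V} {P : MvPolynomial (Fin (N + 1)) ℂ} {a : V} {T : ℕ}
    (h : VanishesToOrder W (M.F P) a T) {g : V → ℂ} (hg : AnalyticOnNhd ℂ g univ) :
    VanishesToOrder W (fun w => g w * M.F P w) a T := by
  intro x hx
  have hga : AnalyticAt ℂ (fun t : ℂ => g (a + t • x)) 0 :=
    (hg _ trivial).comp (analyticAt_const.add (analyticAt_id.smul analyticAt_const))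
  exact forall_iteratedDeriv_mul_eq_zero (M.analyticAt_F_line P a x 0) hga (h x hx)

/-- `F_{BP}` vanishes to the order of `F_P`. [folklore] -/
theorem VanishesToOrder.F_mul {W : Submodule ℂ V} {P : MvPolynomial (Fin (N + 1)) ℂ} {a : V} {T : ℕ}
    (h : VanishesToOrder W (M.F P) a T) (B : MvPolynomial (Fin (N + 1)) ℂ) :
    VanishesToOrder W (M.F (B * P)) a T := by
  have := h.mul_left M (M.analyticOnNhd_F B)
  have heq : M.F (B * P) = fun w => M.F B w * M.F P w := by funext w; simp
  rw [heq]
  exact this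

/-- `F_{P+Q}` vanishes to the common order. [folklore] -/
theorem VanishesToOrder.F_add {W : Submodule ℂ V} {P Q : MvPolynomial (Fin (N + 1)) ℂ} {a : V} {T : ℕ}
    (hP : VanishesToOrder W (M.F P) a T) (hQ : VanishesToOrder W (M.F Q) a T) :
    VanishesToOrder W (M.F (P + Q)) a T := by
  intro x hx k hk
  have hcP : ContDiffAt ℂ k (fun t : ℂ => M.F P (a + t • x)) 0 := (M.analyticAt_F_line P a x 0).contDiffAt
  have hcQ : ContDiffAt ℂ k (fun t : ℂ => M.F Q (a + t • x)) 0 := (M.analyticAt_F_line Q a x 0).contDiffAt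
  have := iteratedDeriv_add hcP hcQ
  have heq : (fun t : ℂ => M.F (P + Q) (a + t • x)) =
      (fun t : ℂ => M.F P (a + t • x)) + fun t : ℂ => M.F Q (a + t • x) := by
    funext t; simp
  rw [heq, this, hP x hx k hk, hQ x hx k hk, add_zero]

/-- Members of an ideal generated by forms vanishing to order `T` vanish to order `T`. [folklore] -/
theorem VanishesToOrder.of_mem_span {W : Submodule ℂ V} {a : V} {T : ℕ}
    {S : Set (MvPolynomial (Fin (N + 1)) ℂ)} (hS : ∀ P ∈ S, VanishesToOrder W (M.F P) a T)
    {Q : MvPolynomial (Fin (N + 1)) ℂ} (hQ : Q ∈ Ideal.span S) : VanishesToOrder W (M.F Q) a T := by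
  induction hQ using Submodule.span_induction with
  | mem P hP => exact hS P hP
  | zero =>
    intro x _ k _
    have : (fun t : ℂ => M.F 0 (a + t • x)) = 0 := by funext t; simp
    rw [this, iteratedDeriv_const_zero]
  | add P Q _ _ hP hQ => exact hP.F_add M hQ
  | smul B P _ hP => exact hP.F_mul M B

/-! ### The bridge: orders of forms and pure words -/

/-- **At a chart point, the order of a form along `W` is read on the pure words `𝒟_x^k P`.**
For `Θ_{J₀}(a) ≠ 0` and a form `P` of degree `D`:
`F_P` vanishes to order `T` along `W` at `a` iff `F_{𝒟_{J₀,x}^k P}(a) = 0` for all `x ∈ W`, `k < T`.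
[cite: NesterenkoPhilippon2001, Ch. 11 Def. 3.2 and Prop. 3.6 (iii)] -/
theorem vanishesToOrder_iff_chartDer {J₀ : Fin (N + 1)} {a : V} (ha : M.Θ J₀ a ≠ 0)
    {P : MvPolynomial (Fin (N + 1)) ℂ} {D : ℕ} (hP : P.IsHomogeneous D) (W : Submodule ℂ V) (T : ℕ) :
    VanishesToOrder W (M.F P) a T ↔ ∀ x ∈ W, ∀ k < T, M.F ((M.chartDer J₀ x)^[k] P) a = 0 := by
  refine forall₂_congr fun x hx => ?_
  -- order transfer between `F_P(a+tx)` and `F_P(a+tx)/Θ_{J₀}(a+tx)^D`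
  have hf : AnalyticAt ℂ (fun t : ℂ => M.F P (a + t • x) / M.Θ J₀ (a + t • x) ^ D) 0 :=
    (M.analyticAt_F_line P a x 0).div ((M.analyticAt_Θ_line J₀ a x 0).pow D) (by simpa using pow_ne_zero D ha)
  have hg : AnalyticAt ℂ (fun t : ℂ => M.Θ J₀ (a + t • x) ^ D) 0 := (M.analyticAt_Θ_line J₀ a x 0).pow D
  have hg0 : M.Θ J₀ (a + (0 : ℂ) • x) ^ D ≠ 0 := by simpa using pow_ne_zero D ha
  have hprod : (fun t : ℂ => M.Θ J₀ (a + t • x) ^ D * (M.F P (a + t • x) / M.Θ J₀ (a + t • x) ^ D)) =ᶠ[𝓝 0]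
      fun t : ℂ => M.F P (a + t • x) := by
    have hev : ∀ᶠ t : ℂ in 𝓝 0, M.Θ J₀ (a + t • x) ≠ 0 :=
      (M.differentiableAt_Θ_line J₀ a x 0).continuousAt.eventually_ne (by simpa using ha)
    filter_upwards [hev] with t ht
    rw [mul_div_cancel₀ _ (pow_ne_zero D ht)]
  have key := forall_iteratedDeriv_mul_eq_zero_iff_of_ne_zero hf hg hg0 T
  have hiter : ∀ k, iteratedDeriv k (fun t : ℂ => M.Θ J₀ (a + t • x) ^ D *
      (M.F P (a + t • x) / M.Θ J₀ (a + t • x) ^ D)) 0 = iteratedDeriv k (fun t : ℂ => M.F P (a + t • x)) 0 :=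
    fun k => hprod.iteratedDeriv_eq k
  simp only [hiter] at key
  rw [key]
  refine forall₂_congr fun k _ => ?_
  rw [M.F_chartDer_iterate J₀ x hP k ha]
  simp [pow_ne_zero _ ha]

end AnalyticGroupModel

end Literature.NumberTheory.Transcendental
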